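/-
Copyright (c) 2026 the pub-hodgecm-mathlib formalisation cell (harness21).  Prover seat hodgecm-mathlib-LH4-p06 (g4), req620 Track A «(D-RAM) FOUR-FRAME» squad
(unit U3_Laws under (R-22) «κS-RECUT», brick «κB-H·Ω» = organ (C0) of LH4-p04 (g3)'s KSB02-PAYER-PLAN v1: THE CORE-HANGING (H-CORNER) AND FOOT-0 SIGN TOKENS IN Ω-CURRENCY;
dealer∕pen LH4-plan (g12) WORD #2 (3) «EQUILATERAL CORNER», heir LEAD F0P3a-plan (g19) T18-53 ORDER OF SHAPE Q5, REF5 (g22) R5-115 (4) ∕ R5-117 (A) ∕ R5-135, LETTER κB-H·Ω v1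
de01aadc27b77292, machine twin LH4-r01 (g4) «GW» (q = 4, (4,4): 2052∕2052 alive H slot-rows)).  2026-09-04.
ED. 2 (append-only; §1–§3 byte-identical to ★ p857084): + §4 PER-SLOT CONVENIENCES for the (D)∕(D₂) payers — the apex slot 0 under the `|1 − g|`-relative bound ALONE and the
cross slot 2 under the `|g|`-relative bound ALONE (LH4-r01 (g4) «BOX HB» usage note: on a G-foot the apex rows are alive on shells where only the absolute = `|1 − g|`-relative
precision reaches `2d − 1`; the bundled heads of §2 ask both bounds and cannot serve those rows).
-/
import Summits.HodgeConjecture.HodgeConjecture.Theorems.F0P3cDyRamDiagonalGlueSignEval   -- ★ LH4-p04 (g2): `glueSign_eq_normSign`, `isGlueRep_div`, `glueSign_div_mul`, the dictionary heads in Ω-currency; brings ★ GlueSignDefs, ★ Recut p856880, ★ κS-DICT p856809, ★ ω-conductor toolkit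
import HarnessLib

/-!
# Crux `H413`, line LH4 «(D-RAM) FOUR-FRAME» road — unit U3_Laws (iii), (R-22) «κS-RECUT»: brick «κB-H·Ω» — THE CORE-HANGING SIGN TOKENS IN Ω-CURRENCY
# `(ω(−(1+f₀)), ω(f₀)ω(−(1+f₀)), ω(f₀))_i = Ω((b, a, b∕a)_i) · (ω(−1), ω(−1), 1)_i · baseSign_i · ω(fPartProd δ (a,b,1) i)`, the glue representatives being supplied by the glue witness itself

Cell `hodgecm-mathlib` (D-0151), FLOOR 0, crux item H413 = `stmt-HodgeConjecture-24833`, route of record `HCCMUnconditional`; squad F0∕P3c∕LH4 (req618∕req620); registered stubs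
concerned: the Ω-aware re-lettered κS leaves (κS-B₀²)∕(κS-B₂²) of `Cruxes/H413/Lines/F0_P3c_DyRamFourFrame_U3_Laws.lean` (heir LEAD T18-53), at their H CORNER (the
core-hanging strata, equilateral key `n₁ = n₂ = n₃`).  THEOREMS ONLY (no `def`, no instance, no notation, no `sorry`, default heartbeats); lane
`--supports stmt-HodgeConjecture-24833 --as helper` (count-neutral).

WHY.  The ★ core-hanging κ-sockets — tv 0 `…DiagonalKappaCoreHangingSocket.finsum_kappaCount_mul_stabiliserWeight_hasAxis_H` (p856750) and tv 2
`…DiagonalKappaCoreHangingTwoSocket.finsum_kappaCount_mul_stabiliserWeight_hasAxis_H_two` (p856890) — carry, on an alive shell, the SAME sign token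
`![normSign σ (-(1 + f₀)), normSign σ f₀ * normSign σ (-(1 + f₀)), normSign σ f₀] i` in a σ-FIXED glue witness `f₀` (`|f₀ + g| ≤ |ϖ|^e`, `g = (β − 1)∕(α − 1)`, `α = a²`,
`β = b²`, `e ≥ 2d − 1` = the alive conjunct `d ≤ ⌈e∕2⌉`).  The re-lettered κ-sign children read the RHS token `Ω K σ ϖ d a b i * (w_i * (baseSign σ i * ω(fPartProd δ (a,b,1) i)))`,
`w = (ω(−1), ω(−1), 1)` (★ `…KappaSignModelSum2OfKappaStageB`), with the schedule of record `Ω := omegaR`, `omegaR K σ ϖ d a b i = glueSignR σ ϖ d a b i = glueSign σ ϖ d ((b, a, b∕a)_i)`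
(★ `…OmegaRDefs`, ★ `…DiagonalGlueSignDefs`).  THIS FILE is the dictionary between the two at the H corner: §1 the three glue representatives (`IsGlueRep`, level `2d − 1`) of
`b∕a`, `b`, `a` EXIST and are EXPLICIT in the glue witness — `u₂ = f₀·x₀₂∕x₂₁`, `u₀ = (1 + f₀)·x₀₂∕x₀₁`, `u₁ = u₀∕u₂` (`x_ij = fPart δ (a,b,1) i j`, KEY ALGEBRA ★ p856809
`−g = (b∕a)·x₂₁∕x₀₂`, `1 − g = b·x₀₁∕x₀₂`) — so NO representative binder is needed where a glue witness is in hand; the witness precision is a LEVEL `n` with `2d − 1 ≤ n`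
(LH4-p04 (g3) KSB02-PAYER-PLAN v1 §5 ask; monotonicity `|ϖ|^n ≤ |ϖ|^{2d−1}` inside); §2 the HEAD: the socket token equals the `glueSignR`-twisted law token, slot by slot, for every
`i : Fin 3` (★ `…GlueSignEval` §2 + `ω` multiplicative on fixed elements), and its FOOT-0 twin `footZeroToken_eq_glueSignR_mul` for the glued-foot vector
`(ω(−1)ω(1+f₀), ω(−1)ω(f₀)ω(1+f₀), ω(f₀))` (payer plan (C0)); §3 the EQUILATERAL COROLLARY under the sockets' own binders (`|b² − 1| = |a² − 1| = |b² − a²| = |ϖ|^m`, ONE absolute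
glue depth `|f₀ + g| ≤ |ϖ|^n`, `2d − 1 ≤ n`): there `|g| = |1 − g| = 1`, `f₀ ≠ 0`, `1 + f₀ ≠ 0` are forced, and the head applies verbatim.
HONEST LABEL.  Count-neutral (`--supports`); dictionary algebra only — nothing printed is asserted, the κS laws stay PROVER TARGETS under (R-22); `HC_CM` is proved only modulo the 7
printed citations (2 remaining named inputs: hLiu418 = `stmt-HodgeConjecture-24832`, h413 = `stmt-HodgeConjecture-24833`) until rung 0 closes.

## References
* [Serre1979] J.-P. Serre, *Local Fields*, GTM 67 (1979), Ch. V §3 Prop. 5, Cor. 3 (conductor of a ramified quadratic extension; deep one-units of `F` are norms), Ch. XV §2.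
* [Rogawski1990] J. D. Rogawski, *Automorphic Representations of Unitary Groups in Three Variables*, Ann. of Math. Stud. 123 (1990), §4.9 Prop. 4.9.1 (a) p. 55, §4.10 p. 58.
* [LanglandsShelstad1987] R. P. Langlands, D. Shelstad, *On the definition of transfer factors*, Math. Ann. 278 (1987), §3.
-/

set_option autoImplicit false

noncomputable section

namespace Summit.HodgeConjecture.HodgeConjecture.Cruxes.H413.F0P3cDyRamDiagonalKappaCoreHangingOmega

open Literature.NumberTheory.Automorphic Literature.NumberTheory.Automorphic.UnitaryThreeFourFrame
open Literature.NumberTheory.LocalFields Literature.NumberTheory.LocalFields.WildQuadraticDatum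
open Summit.HodgeConjecture.HodgeConjecture.Cruxes.H413.F0P3cDyRamDiagonalGlueSignDefs
open Summit.HodgeConjecture.HodgeConjecture.Cruxes.H413.F0P3cDyRamDiagonalGlueSignEval
open Summit.HodgeConjecture.HodgeConjecture.Cruxes.H413.F0P3cDyRamDiagonalKappaSignDictionary
open WithZero
open scoped Valued

variable {K : Type} [Field K] [Valued K ℤᵐ⁰]

/-! ## §1  The glue representatives of `b∕a`, `b`, `a` carried by a glue witness -/

/-- A σ-fixed element `|ϖ|^{2d−1}`-close to a unit `w` (`d ≥ 1`) is a glue representative of `w` (it is itself a unit). [cite: Serre1979, Ch. V §3 Cor. 3] -/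
theorem isGlueRep_of_v_sub_le {σ : K →+* K} {ϖ : K} {d : ℕ} (hϖ : Valued.v ϖ = exp (-1 : ℤ)) (hd : 1 ≤ d) {w u : K} (hw : Valued.v w = 1)
    (hσu : σ u = u) (hwu : Valued.v (w - u) ≤ Valued.v ϖ ^ (2 * d - 1)) : IsGlueRep σ ϖ d w u := by
  refine ⟨hσu, ?_, hwu⟩
  have hϖ1 : Valued.v ϖ < 1 := by rw [hϖ, ← exp_zero, exp_lt_exp]; omega
  have hlt : Valued.v ϖ ^ (2 * d - 1) < 1 := pow_lt_one₀ zero_le hϖ1 (by omega)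
  have h : Valued.v (u - w) < Valued.v w := by
    rw [Valuation.map_sub_swap, hw]; exact hwu.trans_lt hlt
  rw [Valuation.map_eq_of_sub_lt _ h, hw]

/-- Monotonicity of the glue precision: `|ϖ|^n ≤ |ϖ|^{2d−1}` for `2d − 1 ≤ n` (a witness at precision `n` is a witness at the dictionary's level). [cite: Serre1979, Ch. II §1] -/
theorem v_pow_le_pow_glueLevel {ϖ : K} (hϖ : Valued.v ϖ = exp (-1 : ℤ)) {d n : ℕ} (hn : 2 * d - 1 ≤ n) :
    Valued.v ϖ ^ n ≤ Valued.v ϖ ^ (2 * d - 1) := by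
  have hϖ1 : Valued.v ϖ < 1 := by rw [hϖ, ← exp_zero, exp_lt_exp]; omega
  exact pow_le_pow_right_of_le_one' hϖ1.le hn

/-- **`u₂ := f₀·x₀₂∕x₂₁` REPRESENTS `b∕a`** whenever `f₀` is a σ-fixed glue witness at a precision `n ≥ 2d − 1` RELATIVE to `|g|`, `|f₀ + g| ≤ |ϖ|^n·|g|` (`g = (b²−1)∕(a²−1)`;
`x_ij = fPart δ (a,b,1) i j`): `b∕a − u₂ = −(f₀ + g)·x₀₂∕x₂₁` by the KEY ALGEBRA `−g = (b∕a)·x₂₁∕x₀₂`, and `|g·x₀₂∕x₂₁| = |b∕a| = 1`.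
[cite: Rogawski1990, §4.9 p. 55, §4.10 p. 58] [cite: Serre1979, Ch. V §3 Cor. 3] -/
theorem isGlueRep_div_of_glueWitness {σ : K →+* K} {ϖ : K} {d t : ℕ} (hD : IsRamifiedQuadraticDatum σ ϖ d t)
    {δ a b : K} (hδ : σ δ = -δ) (hδ0 : δ ≠ 0) (ha : a * σ a = 1) (hb : b * σ b = 1) (hα1 : a * a ≠ 1) (hβ1 : b * b ≠ 1)
    {f₀ : K} (hσf₀ : σ f₀ = f₀) {n : ℕ} (hn : 2 * d - 1 ≤ n) (hf₀ : Valued.v (f₀ + (b * b - 1) / (a * a - 1)) ≤ Valued.v ϖ ^ n * Valued.v ((b * b - 1) / (a * a - 1))) :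
    IsGlueRep σ ϖ d (b / a) (f₀ * (fPart δ ![a, b, 1] 0 2 / fPart δ ![a, b, 1] 2 1)) := by
  obtain ⟨-, hvσ, hϖ, -, -, hd1, -⟩ := id hD
  have hmono := v_pow_le_pow_glueLevel hϖ hn
  have ha0 := ne_zero_of_mul_map_eq_one ha
  have hb0 := ne_zero_of_mul_map_eq_one hb
  have hva : Valued.v a = 1 := v_eq_one_of_mul_map_eq_one hvσ ha
  have hvb : Valued.v b = 1 := v_eq_one_of_mul_map_eq_one hvσ hb
  have hx0 : fPart δ ![a, b, 1] 0 2 ≠ 0 := fPart_ne_zero (l := ![a, b, 1]) hδ0 (by simp [ha0]) (by simp) (by simpa using hα1)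
  have hy0 : fPart δ ![a, b, 1] 2 1 ≠ 0 :=
    fPart_ne_zero (l := ![a, b, 1]) hδ0 (by simp) (by simp [hb0]) (by simpa using fun h => hβ1 h.symm)
  have hw : Valued.v (b / a) = 1 := by rw [map_div₀, hva, hvb, div_one]
  refine isGlueRep_of_v_sub_le hϖ hd1 hw (by rw [map_mul, map_div₀, hσf₀, map_fPart_eq hδ ha hb, map_fPart_eq hδ ha hb]) ?_
  -- `b∕a − u₂ = −(f₀ + g)·(x₀₂∕x₂₁)`
  have hneg := neg_glueUnit_eq (δ := δ) hδ0 ha0 hb0 hα1   -- `−g = (b∕a)·(x₂₁∕x₀₂)`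
  have key : b / a - f₀ * (fPart δ ![a, b, 1] 0 2 / fPart δ ![a, b, 1] 2 1) =
      -(f₀ + (b * b - 1) / (a * a - 1)) * (fPart δ ![a, b, 1] 0 2 / fPart δ ![a, b, 1] 2 1) := by
    have e : b / a = -((b * b - 1) / (a * a - 1)) * (fPart δ ![a, b, 1] 0 2 / fPart δ ![a, b, 1] 2 1) := by
      rw [hneg]; field_simp
    rw [e]; ring
  have hvq : Valued.v ((b * b - 1) / (a * a - 1)) * Valued.v (fPart δ ![a, b, 1] 0 2 / fPart δ ![a, b, 1] 2 1) = 1 := by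
    rw [← map_mul, show (b * b - 1) / (a * a - 1) * (fPart δ ![a, b, 1] 0 2 / fPart δ ![a, b, 1] 2 1) = -(b / a) from by
      rw [← neg_neg ((b * b - 1) / (a * a - 1)), hneg]; field_simp, Valuation.map_neg, hw]
  rw [key, map_mul, Valuation.map_neg]
  calc Valued.v (f₀ + (b * b - 1) / (a * a - 1)) * Valued.v (fPart δ ![a, b, 1] 0 2 / fPart δ ![a, b, 1] 2 1)
      ≤ Valued.v ϖ ^ n * Valued.v ((b * b - 1) / (a * a - 1)) * Valued.v (fPart δ ![a, b, 1] 0 2 / fPart δ ![a, b, 1] 2 1) :=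
        mul_le_mul_left hf₀ _
    _ = Valued.v ϖ ^ n := by rw [mul_assoc, hvq, mul_one]
    _ ≤ Valued.v ϖ ^ (2 * d - 1) := hmono

/-- **`u₀ := (1 + f₀)·x₀₂∕x₀₁` REPRESENTS `b`** whenever `f₀` is a σ-fixed glue witness at a precision `n ≥ 2d − 1` RELATIVE to `|1 − g|`, `|f₀ + g| ≤ |ϖ|^n·|1 − g|`:
`b − u₀ = −(f₀ + g)·x₀₂∕x₀₁` by the KEY ALGEBRA `1 − g = b·x₀₁∕x₀₂`, and `|(1 − g)·x₀₂∕x₀₁| = |b| = 1`. [cite: Rogawski1990, §4.9 p. 55, §4.10 p. 58] [cite: Serre1979, Ch. V §3 Cor. 3] -/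
theorem isGlueRep_of_glueWitness {σ : K →+* K} {ϖ : K} {d t : ℕ} (hD : IsRamifiedQuadraticDatum σ ϖ d t)
    {δ a b : K} (hδ : σ δ = -δ) (hδ0 : δ ≠ 0) (ha : a * σ a = 1) (hb : b * σ b = 1) (hα1 : a * a ≠ 1) (hαβ : a * a ≠ b * b)
    {f₀ : K} (hσf₀ : σ f₀ = f₀) {n : ℕ} (hn : 2 * d - 1 ≤ n) (hf₀' : Valued.v (f₀ + (b * b - 1) / (a * a - 1)) ≤ Valued.v ϖ ^ n * Valued.v (1 - (b * b - 1) / (a * a - 1))) :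
    IsGlueRep σ ϖ d b ((1 + f₀) * (fPart δ ![a, b, 1] 0 2 / fPart δ ![a, b, 1] 0 1)) := by
  obtain ⟨-, hvσ, hϖ, -, -, hd1, -⟩ := id hD
  have hmono := v_pow_le_pow_glueLevel hϖ hn
  have ha0 := ne_zero_of_mul_map_eq_one ha
  have hb0 := ne_zero_of_mul_map_eq_one hb
  have hvb : Valued.v b = 1 := v_eq_one_of_mul_map_eq_one hvσ hb
  have hx0 : fPart δ ![a, b, 1] 0 2 ≠ 0 := fPart_ne_zero (l := ![a, b, 1]) hδ0 (by simp [ha0]) (by simp) (by simpa using hα1)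
  have hz0 : fPart δ ![a, b, 1] 0 1 ≠ 0 := fPart_ne_zero (l := ![a, b, 1]) hδ0 (by simp [ha0]) (by simp [hb0]) (by simpa using hαβ)
  refine isGlueRep_of_v_sub_le hϖ hd1 hvb
    (by rw [map_mul, map_add, map_one, map_div₀, hσf₀, map_fPart_eq hδ ha hb, map_fPart_eq hδ ha hb]) ?_
  have hone := one_sub_glueUnit_eq (δ := δ) hδ0 ha0 hb0 hα1   -- `1 − g = b·(x₀₁∕x₀₂)`
  have key : b - (1 + f₀) * (fPart δ ![a, b, 1] 0 2 / fPart δ ![a, b, 1] 0 1) =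
      -(f₀ + (b * b - 1) / (a * a - 1)) * (fPart δ ![a, b, 1] 0 2 / fPart δ ![a, b, 1] 0 1) := by
    have e : b = (1 - (b * b - 1) / (a * a - 1)) * (fPart δ ![a, b, 1] 0 2 / fPart δ ![a, b, 1] 0 1) := by
      rw [hone]; field_simp
    nth_rw 1 [e]; ring
  have hvq : Valued.v (1 - (b * b - 1) / (a * a - 1)) * Valued.v (fPart δ ![a, b, 1] 0 2 / fPart δ ![a, b, 1] 0 1) = 1 := by
    rw [← map_mul, hone, show b * (fPart δ ![a, b, 1] 0 1 / fPart δ ![a, b, 1] 0 2) * (fPart δ ![a, b, 1] 0 2 / fPart δ ![a, b, 1] 0 1) = b from by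
      field_simp, hvb]
  rw [key, map_mul, Valuation.map_neg]
  calc Valued.v (f₀ + (b * b - 1) / (a * a - 1)) * Valued.v (fPart δ ![a, b, 1] 0 2 / fPart δ ![a, b, 1] 0 1)
      ≤ Valued.v ϖ ^ n * Valued.v (1 - (b * b - 1) / (a * a - 1)) * Valued.v (fPart δ ![a, b, 1] 0 2 / fPart δ ![a, b, 1] 0 1) :=
        mul_le_mul_left hf₀' _
    _ = Valued.v ϖ ^ n := by rw [mul_assoc, hvq, mul_one]
    _ ≤ Valued.v ϖ ^ (2 * d - 1) := hmono

/-- **`u₁ := u₀∕u₂` REPRESENTS `a = b∕(b∕a)`** whenever both glue depths hold (★ `isGlueRep_div`). [cite: Serre1979, Ch. V §3 Cor. 3] [cite: Rogawski1990, §4.10 p. 58] -/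
theorem isGlueRep_root_of_glueWitness {σ : K →+* K} {ϖ : K} {d t : ℕ} (hD : IsRamifiedQuadraticDatum σ ϖ d t)
    {δ a b : K} (hδ : σ δ = -δ) (hδ0 : δ ≠ 0) (ha : a * σ a = 1) (hb : b * σ b = 1) (hα1 : a * a ≠ 1) (hβ1 : b * b ≠ 1) (hαβ : a * a ≠ b * b)
    {f₀ : K} (hσf₀ : σ f₀ = f₀) {n : ℕ} (hn : 2 * d - 1 ≤ n) (hf₀ : Valued.v (f₀ + (b * b - 1) / (a * a - 1)) ≤ Valued.v ϖ ^ n * Valued.v ((b * b - 1) / (a * a - 1)))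
    (hf₀' : Valued.v (f₀ + (b * b - 1) / (a * a - 1)) ≤ Valued.v ϖ ^ n * Valued.v (1 - (b * b - 1) / (a * a - 1))) :
    IsGlueRep σ ϖ d a (((1 + f₀) * (fPart δ ![a, b, 1] 0 2 / fPart δ ![a, b, 1] 0 1)) / (f₀ * (fPart δ ![a, b, 1] 0 2 / fPart δ ![a, b, 1] 2 1))) := by
  have hvσ := hD.2.1
  have ha0 := ne_zero_of_mul_map_eq_one ha
  have hb0 := ne_zero_of_mul_map_eq_one hb
  have hva : Valued.v a = 1 := v_eq_one_of_mul_map_eq_one hvσ ha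
  have hvb : Valued.v b = 1 := v_eq_one_of_mul_map_eq_one hvσ hb
  have hw : Valued.v (b / a) = 1 := by rw [map_div₀, hva, hvb, div_one]
  have h := isGlueRep_div hw (isGlueRep_div_of_glueWitness hD hδ hδ0 ha hb hα1 hβ1 hσf₀ hn hf₀) (isGlueRep_of_glueWitness hD hδ hδ0 ha hb hα1 hαβ hσf₀ hn hf₀')
  rwa [div_div_cancel₀ hb0] at h
  -- `b ∕ (b ∕ a) = a`

/-- **ALL THREE AXES CARRY A REPRESENTATIVE** at the H corner: `∃ u, IsGlueRep σ ϖ d w u` for `w ∈ {b∕a, b, a}` from the glue witness alone (so `glueSign` is never junk there).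
[cite: Serre1979, Ch. V §3 Cor. 3] [cite: Rogawski1990, §4.10 p. 58] -/
theorem exists_isGlueRep_of_glueWitness {σ : K →+* K} {ϖ : K} {d t : ℕ} (hD : IsRamifiedQuadraticDatum σ ϖ d t)
    {δ a b : K} (hδ : σ δ = -δ) (hδ0 : δ ≠ 0) (ha : a * σ a = 1) (hb : b * σ b = 1) (hα1 : a * a ≠ 1) (hβ1 : b * b ≠ 1) (hαβ : a * a ≠ b * b)
    {f₀ : K} (hσf₀ : σ f₀ = f₀) {n : ℕ} (hn : 2 * d - 1 ≤ n) (hf₀ : Valued.v (f₀ + (b * b - 1) / (a * a - 1)) ≤ Valued.v ϖ ^ n * Valued.v ((b * b - 1) / (a * a - 1)))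
    (hf₀' : Valued.v (f₀ + (b * b - 1) / (a * a - 1)) ≤ Valued.v ϖ ^ n * Valued.v (1 - (b * b - 1) / (a * a - 1))) :
    (∃ u : K, IsGlueRep σ ϖ d (b / a) u) ∧ (∃ u : K, IsGlueRep σ ϖ d b u) ∧ (∃ u : K, IsGlueRep σ ϖ d a u) :=
  ⟨⟨_, isGlueRep_div_of_glueWitness hD hδ hδ0 ha hb hα1 hβ1 hσf₀ hn hf₀⟩, ⟨_, isGlueRep_of_glueWitness hD hδ hδ0 ha hb hα1 hαβ hσf₀ hn hf₀'⟩,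
    ⟨_, isGlueRep_root_of_glueWitness hD hδ hδ0 ha hb hα1 hβ1 hαβ hσf₀ hn hf₀ hf₀'⟩⟩

/-! ## §2  HEAD — the core-hanging socket token IS the `glueSignR`-twisted law token, slot by slot -/

/-- **κB-H·Ω HEAD: THE CORE-HANGING SIGN TOKEN IN Ω-CURRENCY.**  For a σ-fixed glue witness `f₀` (`f₀ ≠ 0`, `1 + f₀ ≠ 0`) with both relative glue depths at a precision
`n ≥ 2d − 1` (`|f₀ + g| ≤ |ϖ|^n·|g|` and `≤ |ϖ|^n·|1 − g|`, `g = (b²−1)∕(a²−1)`), at a non-degenerate square datum (`a² ≠ 1`, `b² ≠ 1`, `a² ≠ b²`, skew `δ ≠ 0`), for EVERY slot `i`: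
`(ω(−(1+f₀)), ω(f₀)·ω(−(1+f₀)), ω(f₀))_i = glueSignR σ ϖ d a b i · ((ω(−1), ω(−1), 1)_i · (baseSign σ i · ω(fPartProd δ (a,b,1) i)))` — the LHS is the ★ tv-0∕tv-2 core-hanging socket
token verbatim, the RHS is the (κS-B₀²)∕(κS-B₂²) sign token at the schedule of record (`omegaR K σ ϖ d a b i = glueSignR σ ϖ d a b i`).  No representative binder: §1 supplies them.
[cite: Rogawski1990, §4.9 Prop. 4.9.1 (a) p. 55, §4.10 p. 58] [cite: Serre1979, Ch. V §3 Prop. 5, Cor. 3] [cite: LanglandsShelstad1987, §3] -/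
theorem coreHangingToken_eq_glueSignR_mul [CompleteSpace K] [Fintype 𝓀[K]] {σ : K →+* K} {ϖ : K} {d t : ℕ} (hD : IsRamifiedQuadraticDatum σ ϖ d t)
    {δ a b : K} (hδ : σ δ = -δ) (hδ0 : δ ≠ 0) (ha : a * σ a = 1) (hb : b * σ b = 1) (hα1 : a * a ≠ 1) (hβ1 : b * b ≠ 1) (hαβ : a * a ≠ b * b)
    {f₀ : K} (hσf₀ : σ f₀ = f₀) (hf0 : f₀ ≠ 0) (hf1 : 1 + f₀ ≠ 0) {n : ℕ} (hn : 2 * d - 1 ≤ n)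
    (hf₀ : Valued.v (f₀ + (b * b - 1) / (a * a - 1)) ≤ Valued.v ϖ ^ n * Valued.v ((b * b - 1) / (a * a - 1)))
    (hf₀' : Valued.v (f₀ + (b * b - 1) / (a * a - 1)) ≤ Valued.v ϖ ^ n * Valued.v (1 - (b * b - 1) / (a * a - 1))) (i : Fin 3) :
    (![normSign σ (-(1 + f₀)), normSign σ f₀ * normSign σ (-(1 + f₀)), normSign σ f₀] : Fin 3 → ℤ) i =
      glueSignR σ ϖ d a b i * (((![normSign σ (-1 : K), normSign σ (-1 : K), 1] : Fin 3 → ℤ) i) * (baseSign σ i * normSign σ (fPartProd δ ![a, b, 1] i))) := by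
  obtain ⟨hrq, hrb, hra⟩ := exists_isGlueRep_of_glueWitness hD hδ hδ0 ha hb hα1 hβ1 hαβ hσf₀ hn hf₀ hf₀'
  -- the precision-`n` depths are depths at the dictionary's level `2d − 1`
  have hmono := v_pow_le_pow_glueLevel hD.2.2.1 hn
  replace hf₀ := hf₀.trans (mul_le_mul_left hmono _)
  replace hf₀' := hf₀'.trans (mul_le_mul_left hmono _)
  have hσf1 : σ (1 + f₀) = 1 + f₀ := by rw [map_add, map_one, hσf₀]
  -- `ω(−(1+f₀)) = ω(−1)·ω(1+f₀)`
  have hneg : normSign σ (-(1 + f₀)) = normSign σ (-1) * normSign σ (1 + f₀) := by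
    rw [neg_eq_neg_one_mul, normSign_mul_of_fixed hD (by rw [map_neg, map_one]) hσf1 (neg_ne_zero.2 one_ne_zero) hf1]
  have h2 := normSign_glueWitness_eq_glueSign hD hδ hδ0 ha hb hα1 hβ1 hσf₀ hf0 hrq hf₀                       -- slot 2: `ω(f₀) = Ω(b∕a)·(ω(−1)·ω(fPP₂))`
  have h0 := normSign_one_add_glueWitness_eq_glueSign hD hδ hδ0 ha hb hα1 hαβ hσf₀ hf1 hrb hf₀'                 -- slot 0: `ω(1+f₀) = Ω(b)·ω(fPP₀)`
  have h1 := normSign_glueWitness_mul_one_add_eq_glueSign hD hδ hδ0 ha hb hα1 hβ1 hαβ hσf₀ hf0 hf1 hra hrb hf₀ hf₀'  -- slot 1: `ω(f₀(1+f₀)) = Ω(a)·ω(fPP₁)`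
  obtain ⟨g0, g1, g2⟩ := glueSignR_apply σ ϖ d a b
  fin_cases i
  · show normSign σ (-(1 + f₀)) = glueSignR σ ϖ d a b 0 * (normSign σ (-1) * (baseSign σ 0 * normSign σ (fPartProd δ ![a, b, 1] 0)))
    rw [hneg, h0, g0, show baseSign σ (0 : Fin 3) = 1 from rfl]; ring
  · show normSign σ f₀ * normSign σ (-(1 + f₀)) = glueSignR σ ϖ d a b 1 * (normSign σ (-1) * (baseSign σ 1 * normSign σ (fPartProd δ ![a, b, 1] 1)))
    rw [hneg, mul_left_comm, ← normSign_mul_of_fixed hD hσf₀ hσf1 hf0 hf1, h1, g1, show baseSign σ (1 : Fin 3) = 1 from rfl]; ring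
  · show normSign σ f₀ = glueSignR σ ϖ d a b 2 * (1 * (baseSign σ 2 * normSign σ (fPartProd δ ![a, b, 1] 2)))
    rw [h2, g2, show baseSign σ (2 : Fin 3) = normSign σ (-1) from rfl]; ring

/-- **FOOT 0 IN Ω-CURRENCY (the G₁-foot token).**  Same witness, same hypotheses: the glued-foot-0 token `(ω(−1)·ω(1+f₀), ω(−1)·ω(f₀)·ω(1+f₀), ω(f₀))_i` (★ (κ-B₀) payer's `εG 0`,
the ★ G₁ socket `…KappaGluedSocket.…_hasAxis_G1` signs slot by slot) equals the SAME `glueSignR`-twisted law token — it IS the core-hanging vector after `ω(−(1+f₀)) = ω(−1)·ω(1+f₀)`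
(LH4-p04 (g3) KSB02-PAYER-PLAN v1 §2 (C0) «`footZeroToken_eq_glueSignR_mul`»). [cite: Rogawski1990, §4.9 Prop. 4.9.1 (a) p. 55, §4.10 p. 58] [cite: Serre1979, Ch. V §3 Prop. 5, Cor. 3] -/
theorem footZeroToken_eq_glueSignR_mul [CompleteSpace K] [Fintype 𝓀[K]] {σ : K →+* K} {ϖ : K} {d t : ℕ} (hD : IsRamifiedQuadraticDatum σ ϖ d t)
    {δ a b : K} (hδ : σ δ = -δ) (hδ0 : δ ≠ 0) (ha : a * σ a = 1) (hb : b * σ b = 1) (hα1 : a * a ≠ 1) (hβ1 : b * b ≠ 1) (hαβ : a * a ≠ b * b)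
    {f₀ : K} (hσf₀ : σ f₀ = f₀) (hf0 : f₀ ≠ 0) (hf1 : 1 + f₀ ≠ 0) {n : ℕ} (hn : 2 * d - 1 ≤ n)
    (hf₀ : Valued.v (f₀ + (b * b - 1) / (a * a - 1)) ≤ Valued.v ϖ ^ n * Valued.v ((b * b - 1) / (a * a - 1)))
    (hf₀' : Valued.v (f₀ + (b * b - 1) / (a * a - 1)) ≤ Valued.v ϖ ^ n * Valued.v (1 - (b * b - 1) / (a * a - 1))) (i : Fin 3) :
    (![normSign σ (-1) * normSign σ (1 + f₀), normSign σ (-1) * normSign σ f₀ * normSign σ (1 + f₀), normSign σ f₀] : Fin 3 → ℤ) i =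
      glueSignR σ ϖ d a b i * (((![normSign σ (-1 : K), normSign σ (-1 : K), 1] : Fin 3 → ℤ) i) * (baseSign σ i * normSign σ (fPartProd δ ![a, b, 1] i))) := by
  have hσf1 : σ (1 + f₀) = 1 + f₀ := by rw [map_add, map_one, hσf₀]
  have hneg : normSign σ (-(1 + f₀)) = normSign σ (-1) * normSign σ (1 + f₀) := by
    rw [neg_eq_neg_one_mul, normSign_mul_of_fixed hD (by rw [map_neg, map_one]) hσf1 (neg_ne_zero.2 one_ne_zero) hf1]
  rw [← coreHangingToken_eq_glueSignR_mul hD hδ hδ0 ha hb hα1 hβ1 hαβ hσf₀ hf0 hf1 hn hf₀ hf₀' i]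
  fin_cases i
  · show normSign σ (-1) * normSign σ (1 + f₀) = normSign σ (-(1 + f₀))
    rw [hneg]
  · show normSign σ (-1) * normSign σ f₀ * normSign σ (1 + f₀) = normSign σ f₀ * normSign σ (-(1 + f₀))
    rw [hneg]; ring
  · rfl

/-! ## §3  The EQUILATERAL COROLLARY — the head under the core-hanging sockets' own binders -/

/-- On the EQUILATERAL key `|b² − 1| = |a² − 1| = |b² − a²| (= |ϖ|^m)` the glue unit has `|g| = 1` and `|1 − g| = 1` (`1 − g = (a² − b²)∕(a² − 1)`).
[cite: Rogawski1990, §4.9 p. 55] -/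
theorem v_glueUnit_eq_one_and_of_equilateral {a b : K} {m : ℕ} {ϖ : K} (hϖ0 : ϖ ≠ 0)
    (h₁ : Valued.v (b * b - 1) = Valued.v ϖ ^ m) (h₂ : Valued.v (a * a - 1) = Valued.v ϖ ^ m) (h₃ : Valued.v (b * b - a * a) = Valued.v ϖ ^ m) :
    Valued.v ((b * b - 1) / (a * a - 1)) = 1 ∧ Valued.v (1 - (b * b - 1) / (a * a - 1)) = 1 := by
  have hm0 : Valued.v ϖ ^ m ≠ 0 := pow_ne_zero _ ((Valuation.ne_zero_iff _).2 hϖ0)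
  have hα0 : a * a - 1 ≠ 0 := fun h => hm0 (by rw [← h₂, h, map_zero])
  refine ⟨by rw [map_div₀, h₁, h₂, div_self hm0], ?_⟩
  rw [one_sub_div hα0, map_div₀, show a * a - 1 - (b * b - 1) = -(b * b - a * a) from by ring, Valuation.map_neg, h₃, h₂, div_self hm0]

/-- **κB-H·Ω AT THE SOCKET: THE EQUILATERAL COROLLARY.**  Under the core-hanging sockets' binders — norm-one roots `a, b` of the square datum `(α, β) = (a², b²)`, the equilateral key
`|b² − 1| = |a² − 1| = |b² − a²| = |ϖ|^m`, a σ-fixed glue witness with the ONE ABSOLUTE depth `|f₀ + (b² − 1)∕(a² − 1)| ≤ |ϖ|^n`, `2d − 1 ≤ n` (the alive conjunct `d ≤ ⌈n∕2⌉` of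
★ `…_hasAxis_H` ∕ `…_hasAxis_H_two` gives it) — the socket token equals the `glueSignR`-twisted law token in every slot:
`(ω(−(1+f₀)), ω(f₀)ω(−(1+f₀)), ω(f₀))_i = glueSignR σ ϖ d a b i · ((ω(−1), ω(−1), 1)_i · (baseSign σ i · ω(fPartProd δ (a,b,1) i)))`.  (`f₀ ≠ 0`, `1 + f₀ ≠ 0`, `a² ≠ 1`, `b² ≠ 1`,
`a² ≠ b²` and both relative depths are forced on this key.) [cite: Rogawski1990, §4.9 Prop. 4.9.1 (a) p. 55, §4.10 p. 58] [cite: Serre1979, Ch. V §3 Prop. 5, Cor. 3] [cite: LanglandsShelstad1987, §3] -/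
theorem coreHangingToken_eq_glueSignR_mul_of_equilateral [CompleteSpace K] [Fintype 𝓀[K]] {σ : K →+* K} {ϖ : K} {d t : ℕ} (hD : IsRamifiedQuadraticDatum σ ϖ d t)
    {δ a b : K} (hδ : σ δ = -δ) (hδ0 : δ ≠ 0) (ha : a * σ a = 1) (hb : b * σ b = 1)
    {m : ℕ} (h₁ : Valued.v (b * b - 1) = Valued.v ϖ ^ m) (h₂ : Valued.v (a * a - 1) = Valued.v ϖ ^ m) (h₃ : Valued.v (b * b - a * a) = Valued.v ϖ ^ m)
    {f₀ : K} (hσf₀ : σ f₀ = f₀) {n : ℕ} (hn : 2 * d - 1 ≤ n) (hf₀ : Valued.v (f₀ + (b * b - 1) / (a * a - 1)) ≤ Valued.v ϖ ^ n) (i : Fin 3) :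
    (![normSign σ (-(1 + f₀)), normSign σ f₀ * normSign σ (-(1 + f₀)), normSign σ f₀] : Fin 3 → ℤ) i =
      glueSignR σ ϖ d a b i * (((![normSign σ (-1 : K), normSign σ (-1 : K), 1] : Fin 3 → ℤ) i) * (baseSign σ i * normSign σ (fPartProd δ ![a, b, 1] i))) := by
  obtain ⟨-, -, hϖ, -, -, hd1, -⟩ := id hD
  have hϖ0 : ϖ ≠ 0 := fun h => by rw [h, map_zero] at hϖ; exact exp_ne_zero hϖ.symm
  have hϖ1 : Valued.v ϖ < 1 := by rw [hϖ, ← exp_zero, exp_lt_exp]; omega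
  have hm0 : Valued.v ϖ ^ m ≠ 0 := pow_ne_zero _ ((Valuation.ne_zero_iff _).2 hϖ0)
  have hα1 : a * a ≠ 1 := fun h => hm0 (by rw [← h₂, h, sub_self, map_zero])
  have hβ1 : b * b ≠ 1 := fun h => hm0 (by rw [← h₁, h, sub_self, map_zero])
  have hαβ : a * a ≠ b * b := fun h => hm0 (by rw [← h₃, h, sub_self, map_zero])
  obtain ⟨hg, h1g⟩ := v_glueUnit_eq_one_and_of_equilateral hϖ0 h₁ h₂ h₃
  -- on the equilateral key the ONE absolute depth is both relative depths
  have hrel : Valued.v (f₀ + (b * b - 1) / (a * a - 1)) ≤ Valued.v ϖ ^ n * Valued.v ((b * b - 1) / (a * a - 1)) := by rwa [hg, mul_one]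
  have hrel' : Valued.v (f₀ + (b * b - 1) / (a * a - 1)) ≤ Valued.v ϖ ^ n * Valued.v (1 - (b * b - 1) / (a * a - 1)) := by rwa [h1g, mul_one]
  -- `|f₀| = |g| = 1` and `|1 + f₀| = |1 − g| = 1`, so `f₀ ≠ 0`, `1 + f₀ ≠ 0`
  have hlt : Valued.v ϖ ^ n < 1 := pow_lt_one₀ zero_le hϖ1 (by omega)
  have hsmall : Valued.v (f₀ + (b * b - 1) / (a * a - 1)) < 1 := hf₀.trans_lt hlt
  have hf0 : f₀ ≠ 0 := by
    intro h
    rw [h, zero_add, hg] at hsmall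
    exact lt_irrefl _ hsmall
  have hf1 : 1 + f₀ ≠ 0 := by
    intro h
    have e : f₀ + (b * b - 1) / (a * a - 1) = -(1 - (b * b - 1) / (a * a - 1)) := by
      rw [show f₀ = -1 from by linear_combination h]; ring
    rw [e, Valuation.map_neg, h1g] at hsmall
    exact lt_irrefl _ hsmall
  exact coreHangingToken_eq_glueSignR_mul hD hδ hδ0 ha hb hα1 hβ1 hαβ hσf₀ hf0 hf1 hn hrel hrel' i

/-! ## §4  PER-SLOT CONVENIENCES (ED. 2) — apex slot 0 under the `|1 − g|`-bound alone, cross slot 2 under the `|g|`-bound alone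

On a G-foot the apex-slot glue rows are alive on more shells than the cross slot (★ G₁ socket window `2d ≤ s + 2c` vs `d ≤ c`): there the witness reaches level `2d − 1` only in
the ABSOLUTE (= `|1 − g|`-relative, `|1 − g| = 1` on a foot) precision, so the payer rewrites slot 0 with `apexToken_eq_glueSignR_mul` (one bound), slot 2 with
`crossToken_eq_glueSignR_mul` (one bound), and only slot 1 with the bundled head of §2 (both bounds) — LH4-r01 (g4) «BOX HB», LH4-p04 (g3) plan §1 step 3. -/

/-- **SLOT 0 (APEX) ALONE, H-spelling and foot-spelling: `ω(−(1+f₀)) = ω(−1)·ω(1+f₀) = glueSignR₀ · (ω(−1) · (baseSign₀ · ω(fPP₀)))`** under the ONE relative bound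
`|f₀ + g| ≤ |ϖ|^n·|1 − g|`, `2d − 1 ≤ n` (representative `u₀ = (1+f₀)·x₀₂∕x₀₁` from §1; `baseSign σ 0 = 1`).
[cite: Rogawski1990, §4.9 Prop. 4.9.1 (a) p. 55, §4.10 p. 58] [cite: Serre1979, Ch. V §3 Prop. 5, Cor. 3] -/
theorem apexToken_eq_glueSignR_mul [CompleteSpace K] [Fintype 𝓀[K]] {σ : K →+* K} {ϖ : K} {d t : ℕ} (hD : IsRamifiedQuadraticDatum σ ϖ d t)
    {δ a b : K} (hδ : σ δ = -δ) (hδ0 : δ ≠ 0) (ha : a * σ a = 1) (hb : b * σ b = 1) (hα1 : a * a ≠ 1) (hαβ : a * a ≠ b * b)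
    {f₀ : K} (hσf₀ : σ f₀ = f₀) (hf1 : 1 + f₀ ≠ 0) {n : ℕ} (hn : 2 * d - 1 ≤ n)
    (hf₀' : Valued.v (f₀ + (b * b - 1) / (a * a - 1)) ≤ Valued.v ϖ ^ n * Valued.v (1 - (b * b - 1) / (a * a - 1))) :
    normSign σ (-(1 + f₀)) = glueSignR σ ϖ d a b 0 * (((![normSign σ (-1 : K), normSign σ (-1 : K), 1] : Fin 3 → ℤ) 0) * (baseSign σ 0 * normSign σ (fPartProd δ ![a, b, 1] 0))) ∧
    normSign σ (-1) * normSign σ (1 + f₀) =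
      glueSignR σ ϖ d a b 0 * (((![normSign σ (-1 : K), normSign σ (-1 : K), 1] : Fin 3 → ℤ) 0) * (baseSign σ 0 * normSign σ (fPartProd δ ![a, b, 1] 0))) := by
  have hrb : ∃ u : K, IsGlueRep σ ϖ d b u := ⟨_, isGlueRep_of_glueWitness hD hδ hδ0 ha hb hα1 hαβ hσf₀ hn hf₀'⟩
  have hmono := v_pow_le_pow_glueLevel hD.2.2.1 hn
  have hσf1 : σ (1 + f₀) = 1 + f₀ := by rw [map_add, map_one, hσf₀]
  have hneg : normSign σ (-(1 + f₀)) = normSign σ (-1) * normSign σ (1 + f₀) := by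
    rw [neg_eq_neg_one_mul, normSign_mul_of_fixed hD (by rw [map_neg, map_one]) hσf1 (neg_ne_zero.2 one_ne_zero) hf1]
  have h0 := normSign_one_add_glueWitness_eq_glueSign hD hδ hδ0 ha hb hα1 hαβ hσf₀ hf1 hrb (hf₀'.trans (mul_le_mul_left hmono _))
  have key : normSign σ (-1) * normSign σ (1 + f₀) =
      glueSignR σ ϖ d a b 0 * (((![normSign σ (-1 : K), normSign σ (-1 : K), 1] : Fin 3 → ℤ) 0) * (baseSign σ 0 * normSign σ (fPartProd δ ![a, b, 1] 0))) := by
    rw [h0, (glueSignR_apply σ ϖ d a b).1, show baseSign σ (0 : Fin 3) = 1 from rfl,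
      show ((![normSign σ (-1 : K), normSign σ (-1 : K), 1] : Fin 3 → ℤ) 0) = normSign σ (-1) from rfl]
    ring
  exact ⟨hneg.trans key, key⟩

/-- **SLOT 2 (CROSS) ALONE: `ω(f₀) = glueSignR₂ · (1 · (baseSign₂ · ω(fPP₂)))`** under the ONE relative bound `|f₀ + g| ≤ |ϖ|^n·|g|`, `2d − 1 ≤ n` (representative
`u₂ = f₀·x₀₂∕x₂₁` from §1; `baseSign σ 2 = ω(−1)`). [cite: Rogawski1990, §4.9 Prop. 4.9.1 (a) p. 55, §4.10 p. 58] [cite: Serre1979, Ch. V §3 Prop. 5, Cor. 3] -/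
theorem crossToken_eq_glueSignR_mul [CompleteSpace K] [Fintype 𝓀[K]] {σ : K →+* K} {ϖ : K} {d t : ℕ} (hD : IsRamifiedQuadraticDatum σ ϖ d t)
    {δ a b : K} (hδ : σ δ = -δ) (hδ0 : δ ≠ 0) (ha : a * σ a = 1) (hb : b * σ b = 1) (hα1 : a * a ≠ 1) (hβ1 : b * b ≠ 1)
    {f₀ : K} (hσf₀ : σ f₀ = f₀) (hf0 : f₀ ≠ 0) {n : ℕ} (hn : 2 * d - 1 ≤ n)
    (hf₀ : Valued.v (f₀ + (b * b - 1) / (a * a - 1)) ≤ Valued.v ϖ ^ n * Valued.v ((b * b - 1) / (a * a - 1))) :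
    normSign σ f₀ = glueSignR σ ϖ d a b 2 * (((![normSign σ (-1 : K), normSign σ (-1 : K), 1] : Fin 3 → ℤ) 2) * (baseSign σ 2 * normSign σ (fPartProd δ ![a, b, 1] 2))) := by
  have hrq : ∃ u : K, IsGlueRep σ ϖ d (b / a) u := ⟨_, isGlueRep_div_of_glueWitness hD hδ hδ0 ha hb hα1 hβ1 hσf₀ hn hf₀⟩
  have hmono := v_pow_le_pow_glueLevel hD.2.2.1 hn
  rw [normSign_glueWitness_eq_glueSign hD hδ hδ0 ha hb hα1 hβ1 hσf₀ hf0 hrq (hf₀.trans (mul_le_mul_left hmono _)), (glueSignR_apply σ ϖ d a b).2.2,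
    show baseSign σ (2 : Fin 3) = normSign σ (-1) from rfl, show ((![normSign σ (-1 : K), normSign σ (-1 : K), 1] : Fin 3 → ℤ) 2) = 1 from rfl]
  ring

/-- **SLOT 1 needs BOTH bounds (it is the product of the apex and cross letters): `ω(f₀)·ω(−(1+f₀)) = ω(−1)·ω(f₀)·ω(1+f₀) = glueSignR₁ · (ω(−1) · (baseSign₁ · ω(fPP₁)))`** —
the row `i = 1` of the bundled heads of §2, restated as a scalar pair for uniform per-slot rewriting. [cite: Rogawski1990, §4.9 Prop. 4.9.1 (a) p. 55, §4.10 p. 58] [cite: Serre1979, Ch. V §3 Prop. 5, Cor. 3] -/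
theorem middleToken_eq_glueSignR_mul [CompleteSpace K] [Fintype 𝓀[K]] {σ : K →+* K} {ϖ : K} {d t : ℕ} (hD : IsRamifiedQuadraticDatum σ ϖ d t)
    {δ a b : K} (hδ : σ δ = -δ) (hδ0 : δ ≠ 0) (ha : a * σ a = 1) (hb : b * σ b = 1) (hα1 : a * a ≠ 1) (hβ1 : b * b ≠ 1) (hαβ : a * a ≠ b * b)
    {f₀ : K} (hσf₀ : σ f₀ = f₀) (hf0 : f₀ ≠ 0) (hf1 : 1 + f₀ ≠ 0) {n : ℕ} (hn : 2 * d - 1 ≤ n)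
    (hf₀ : Valued.v (f₀ + (b * b - 1) / (a * a - 1)) ≤ Valued.v ϖ ^ n * Valued.v ((b * b - 1) / (a * a - 1)))
    (hf₀' : Valued.v (f₀ + (b * b - 1) / (a * a - 1)) ≤ Valued.v ϖ ^ n * Valued.v (1 - (b * b - 1) / (a * a - 1))) :
    normSign σ f₀ * normSign σ (-(1 + f₀)) =
        glueSignR σ ϖ d a b 1 * (((![normSign σ (-1 : K), normSign σ (-1 : K), 1] : Fin 3 → ℤ) 1) * (baseSign σ 1 * normSign σ (fPartProd δ ![a, b, 1] 1))) ∧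
    normSign σ (-1) * normSign σ f₀ * normSign σ (1 + f₀) =
        glueSignR σ ϖ d a b 1 * (((![normSign σ (-1 : K), normSign σ (-1 : K), 1] : Fin 3 → ℤ) 1) * (baseSign σ 1 * normSign σ (fPartProd δ ![a, b, 1] 1))) :=
  ⟨coreHangingToken_eq_glueSignR_mul hD hδ hδ0 ha hb hα1 hβ1 hαβ hσf₀ hf0 hf1 hn hf₀ hf₀' 1,
    footZeroToken_eq_glueSignR_mul hD hδ hδ0 ha hb hα1 hβ1 hαβ hσf₀ hf0 hf1 hn hf₀ hf₀' 1⟩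

end Summit.HodgeConjecture.HodgeConjecture.Cruxes.H413.F0P3cDyRamDiagonalKappaCoreHangingOmega
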